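import Literature.Computability.MetaComplexity.ChenTell2019.WordProblemWires
import Literature.Computability.MetaComplexity.NWDesignAC0Mod
import Literature.Computability.Complexity.SymmetricCircuit
import Literature.Computability.Complexity.ThresholdGadgets
import HarnessLib

/-!
# Chen–Tell 2019, Theorems 6/25 and 7/Corollary 23: hardness magnification for `MAJ` in `ACC⁰`
# and for `AND` in `CC⁰`, size = WIRES — census rows R45 and R46 (threshold sides `T`)

Citation header. L. Chen, R. Tell, *Bootstrapping results for threshold circuits "just beyond"
known lower bounds*, STOC 2019, pp. 34–41, doi:10.1145/3313276.3316333; full version ECCC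
TR18-199 (the text materialised in the corpus as `paper:url-8c39e6fb6e2b`; page numbers below are
the PDF pages of that full version). [cite: ChenTell2019]

What is typed here (verbatim sources, PDF pages of the full version):
* §3.1 (p. 13): "The size of a circuit is the number of wires in the circuit"; Definition 11
  (p. 14): "For an integer `q`, the function `MOD_q : {0,1}* → {0,1}` is one if and only if the
  number of ones in the input is not divisible by `q`. The class `CC⁰[q]` is the class of
  constant-depth circuit families with polynomially-many unbounded fan-in `MOD_q` gates. We denote
  `CC⁰ = ∪_{q≥2} CC⁰[q]`. Extending `CC⁰[q]`, the class `AC⁰[q]` is the class of constant-depth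
  circuit families consisting of polynomially-many unbounded fan-in AND, OR and `MOD_q` gates,
  along with unary NOT gates. We denote `ACC⁰ = ∪_{q≥2} AC⁰[q]`."  The tree's
  `GateFn.modGate q k` is literally this `MOD_q` ("`numOnes v % q ≠ 0`"), `accBasis q` is the
  `AC⁰[q]` basis and `Complexity.ACC0 = ⋃ m ≥ 2, AC0Mod m` is this `ACC⁰` (every length,
  size = gates, `acDepth` = depth with negations free).
* Theorem 6 (p. 8): "Assume that for every constant `c > 1` there exist infinitely many `d ∈ ℕ`
  such that MAJ cannot be computed by `ACC⁰` circuits of depth `d` with `n^{1+c^{−d}}` wires.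
  Then, `MAJ ∉ ACC⁰`, and consequently `ACC⁰ ≠ TC⁰`."  (`thm6`, PROVED here from `thm25`.)
* Theorem 25 (p. 22, "whose contrapositive is Theorem 6"): "If `MAJ ∈ ACC⁰`, then there exists a
  constant `c > 1` such that for every sufficiently large constant `d ∈ ℕ` it holds that MAJ can be
  solved by an `ACC⁰` circuit family with depth `d` and `n^{1+c^{−d}}` wires."  (`thm25`, named
  fact.)
* Theorem 7 (p. 8): "Assume that for every constant `c > 1` there exist infinitely many `d ∈ ℕ`
  such that AND cannot be computed by `CC⁰` circuits of depth `d` with `n^{1+c^{−d}}` wires. Then,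
  `CC⁰ ≠ ACC⁰`."  (`thm7`, PROVED here from `cor23`.)
* Corollary 23 (p. 21): "If AND can be computed by `CC⁰` circuits of depth `d₀` and size `n^k`,
  then for every sufficiently large constant `d ∈ ℕ` it holds that AND can be computed by `CC⁰`
  circuits of depth `d` and size `n^{1+2e³·c^{−d}}`, where `c = e^{1/(k·d₀)}`", with the note
  after it (p. 21): "the conclusions of Corollaries 22 and 23 imply that for every sufficiently
  large `d ∈ ℕ`, the corresponding function can be computed by depth-`d` circuits of size
  `n^{1+(c′)^{−d}}`, where `c′ < e^{1/(k·d₀)}`."  (`cor23`, named fact, in the `c′` form.)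
* Known side of row R46 (p. 8, prose only, NOT typed — census rule: a bound in print's words that
  the tree cannot state sharply stays prose): "the best-known lower bounds for computing AND by
  `CC⁰` circuits, which were proved by Chattopadhyay et al. [Cha+06], are of the form `n · f_d(n)`,
  where `f_d(n)` is a slowly-growing function that depends on the circuit depth `d` (i.e.,
  `ω(1) ≤ f_d(n) ≤ log*(n)` for any `d ≥ 2`)."  Row R45 has NO known side in print (p. 8: "there
  are currently no known super-linear lower bounds for computing MAJ by `ACC⁰` circuits").

Modelling decisions (each makes the named facts WEAKER than print, hence safe):
1. Classes with a wire budget are read ALMOST EVERYWHERE (`FamilyAE`, as `TCdWIRESae` of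
   Chen–Jin–Williams 2019 in this tree): `ACdModWIRESae q d s` = families over `accBasis q` with
   `acDepth ≤ d` and `≤ s n` wires at every sufficiently large length; `CCdWIRESae q d s` likewise
   over the pure `MOD_q` basis `ccBasis q`.  Print counts NOT gates in the depth or not — either
   way a print circuit of depth `d` has `acDepth ≤ d`, so a tree hardness hypothesis
   ("`∉ ACdModWIRESae q d s` for every `q ≥ 2`") implies print's, and print's upper-bound
   conclusions imply the tree's.
2. "cannot be computed by `ACC⁰` (resp. `CC⁰`) circuits of depth `d` with `s` wires" is read "for
   EVERY modulus `q ≥ 2`, not by `AC⁰_d[q]` (resp. `CC⁰_d[q]`) circuits with `s` wires"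
   (`MajHardAtBase`, `AndHardAtBase`); "can be solved by an `ACC⁰` circuit family with depth `d`"
   is read "for SOME modulus `q ≥ 2`" (the weakest reading of a conclusion).
3. `CC⁰[q]` is rendered with size = wires (§3.1) and almost everywhere: `CC0q q = {L | ∃ d k,
   L ∈ CCdWIRESae q (d+1) (n ↦ n^(k+1))}` (the shift by one loses nothing, both parameters being
   monotone — `mem_CC0q_of_mem` — and keeps Corollary 23's base `e^{1/(k·d₀)} > 1`);
   `CC0 = ⋃ q ≥ 2, CC0q q`.  Print's "`CC⁰ ≠ ACC⁰`" is rendered `CC0 ≠ Complexity.ACC0`.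
4. `MAJ` is the language of the tree's majority gate `GateFn.maj n` (`[n ≤ 2·#₁(x)]`; print leaves
   the tie convention implicit), `AND` the language of `GateFn.and n`.
5. `wireBound c d n = ⌊n^{1+c^{−d}}⌋` (from `WordProblemWires`): rounding down only shrinks an
   upper-bound class, so hypotheses `∉` get stronger and conclusions `∈` — print's circuits have an
   integer number of wires `≤ n^{1+c^{−d}}`, hence `≤ ⌊n^{1+c^{−d}}⌋` — are implied by print's.

PROVED here (no cite needed beyond folklore): `MAJ ∈ TC0` and `AND ∈ ACC0` by one-gate circuits
(`Circuit.single`), the monotonicity lemmas, `thm6_of_thm25 : thm25 → thm6` (print: "whose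
contrapositive is Theorem 6", p. 22) and `thm7_of_cor23 : cor23 → thm7` (print: "similarly to
Theorem 2 … see Corollary 23", p. 8), and non-vacuity of the new classes.
-/

namespace Literature.Computability.MetaComplexity.ChenTell2019

open Finset Filter
open Literature.Computability.Complexity
open Literature.Computability.MetaComplexity Literature.Computability.MetaComplexity.ChenJinWilliams2019

/-! ### The languages `MAJ` and `AND` -/

/-- The MAJORITY language: `x ∈ MAJ ↔ n ≤ 2·#₁(x)` (the tree's `GateFn.maj`). [cite: ChenTell2019, §1.2.1 (pp. 7–8) and Def. 12 (p. 14)] -/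
def MAJ : Language Bool := {x | (GateFn.maj x.length).2 x.get = true}

/-- The AND language: `x ∈ AND ↔ ∀ i, xᵢ = 1`. [cite: ChenTell2019, Thm. 7 (p. 8)] -/
def AND : Language Bool := {x | (GateFn.and x.length).2 x.get = true}

/-- Membership in `MAJ`, definitional. [folklore] -/
theorem mem_MAJ_iff (x : List Bool) : x ∈ MAJ ↔ (GateFn.maj x.length).2 x.get = true := Iff.rfl

/-- Membership in `AND`, definitional. [folklore] -/
theorem mem_AND_iff (x : List Bool) : x ∈ AND ↔ (GateFn.and x.length).2 x.get = true := Iff.rfl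

/-! ### One-gate circuits: depth and wires -/

section single

variable {ι : Type*}

/-- A one-gate circuit has `acDepth ≤ 1`. [folklore] -/
theorem acDepth_single_le (f : GateFn) (e : Fin f.1 ≃ ι) : (Circuit.single f e).acDepth ≤ 1 := by
  unfold Circuit.acDepth Circuit.depthWith
  simp only [Circuit.single, Circuit.depthVals, List.foldl_cons, List.foldl_nil, List.nil_append,
    List.getD_cons_zero]
  have h0 : (univ.sup fun _ : Fin f.1 => (0 : ℕ)) = 0 :=
    le_antisymm (Finset.sup_le fun _ _ => le_rfl) (Nat.zero_le _)
  unfold acWeight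
  split_ifs <;> simp [h0]

/-- A one-gate circuit has `f.1` wires. [folklore] -/
@[simp] theorem wires_single (f : GateFn) (e : Fin f.1 ≃ ι) : (Circuit.single f e).wires = f.1 := by
  simp [Circuit.wires, Circuit.single]

end single

/-- The one-gate family `n ↦ (fₙ applied to all inputs)` decides the language of `f`. [folklore] -/
theorem decides_single (f : ℕ → GateFn) (hf : ∀ n, (f n).1 = n) (L : Language Bool)
    (hL : ∀ x : List Bool, x ∈ L ↔ (f x.length).2 (fun a => x.get (Fin.cast (hf _) a)) = true) :
    CircuitFamily.Decides
      (fun n => Circuit.single (f n) (finCongr (hf n))) L := by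
  intro x
  rw [Circuit.eval_single]
  by_cases hx : x ∈ L
  · rw [((L : Set (List Bool)).mem_iff_boolIndicator x).1 hx]
    exact (hL x).1 hx
  · rw [((L : Set (List Bool)).notMem_iff_boolIndicator x).1 hx]
    simpa using mt (hL x).2 hx

/-- `∧ₙ ∈ acBasis ⊆ accBasis q` (`and_mem_acBasis`). [folklore] -/
theorem and_mem_accBasis (q n : ℕ) : GateFn.and n ∈ accBasis q :=
  Set.mem_union_left _ (and_mem_acBasis n)

/-- **`MAJ ∈ TC⁰`**: one majority gate per length (depth `1`, size `1`). [folklore] -/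
theorem MAJ_mem_TC0 : MAJ ∈ TC0 := by
  refine ⟨1, 1, fun n => Circuit.single (GateFn.maj n) (finCongr rfl), fun n => ⟨?_, ?_, ?_⟩, ?_⟩
  · exact Circuit.single_isOver (maj_mem_tcBasis n) _
  · exact acDepth_single_le _ _
  · simp
  · exact decides_single GateFn.maj (fun _ => rfl) MAJ fun x => Iff.rfl

/-- **`AND ∈ AC⁰[q]`** for every modulus. [folklore] -/
theorem AND_mem_AC0Mod (q : ℕ) : AND ∈ AC0Mod q := by
  refine ⟨1, 1, fun n => Circuit.single (GateFn.and n) (finCongr rfl), fun n => ⟨?_, ?_, ?_⟩, ?_⟩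
  · exact Circuit.single_isOver (and_mem_accBasis q n) _
  · exact acDepth_single_le _ _
  · simp
  · exact decides_single GateFn.and (fun _ => rfl) AND fun x => Iff.rfl

/-- **`AND ∈ ACC⁰`**. [folklore] -/
theorem AND_mem_ACC0 : AND ∈ ACC0 := AC0Mod_subset_ACC0 le_rfl (AND_mem_AC0Mod 2)

/-! ### The wire classes `AC⁰_d[q]-WIRES[s]` and `CC⁰_d[q]-WIRES[s]` (almost everywhere) -/

/-- The pure `MOD_q` basis of `CC⁰[q]` (Definition 11: "unbounded fan-in `MOD_q` gates" only).
[cite: ChenTell2019, Def. 11 (p. 14)] -/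
def ccBasis (q : ℕ) : Set GateFn := ⋃ k : ℕ, {GateFn.modGate q k}

/-- `MODq,ₙ ∈ ccBasis q`. [folklore] -/
theorem modGate_mem_ccBasis (q n : ℕ) : GateFn.modGate q n ∈ ccBasis q := Set.mem_iUnion.2 ⟨n, rfl⟩

/-- `ccBasis q ⊆ accBasis q` ("`CC⁰` is a subclass of `ACC⁰`", p. 8). [cite: ChenTell2019, Def. 11 (p. 14)] -/
theorem ccBasis_subset_accBasis (q : ℕ) : ccBasis q ⊆ accBasis q := by
  rintro f hf
  obtain ⟨k, hk⟩ := Set.mem_iUnion.1 hf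
  rw [Set.mem_singleton_iff.1 hk]
  exact GFDesign.modGate_mem_accBasis q k

/-- **`AC⁰_d[q]-WIRES[s]`** read almost everywhere: languages decided by a family over `accBasis q`
(`∧`, `∨`, `¬`, `MOD_q`) of `acDepth ≤ d` with at most `s n` wires at every sufficiently large
length ("`ACC⁰` circuits of depth `d` with `s` wires", size = wires, §3.1).
[cite: ChenTell2019, Def. 11 (p. 14) and §3.1 (p. 13)] -/
def ACdModWIRESae (q d : ℕ) (s : ℕ → ℕ) : Set (Language Bool) :=
  FamilyAE fun n C => C.IsOver (accBasis q) ∧ C.acDepth ≤ d ∧ C.wires ≤ s n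

/-- **`CC⁰_d[q]-WIRES[s]`** read almost everywhere: families over the pure `MOD_q` basis of
`acDepth ≤ d` with at most `s n` wires at every sufficiently large length.
[cite: ChenTell2019, Def. 11 (p. 14) and §3.1 (p. 13)] -/
def CCdWIRESae (q d : ℕ) (s : ℕ → ℕ) : Set (Language Bool) :=
  FamilyAE fun n C => C.IsOver (ccBasis q) ∧ C.acDepth ≤ d ∧ C.wires ≤ s n

/-- **`CC⁰[q]`** (Definition 11), size = wires (§3.1), almost everywhere; the depth and exponent
are shifted by one (`d+1`, `k+1`), which loses no language (`mem_CC0q_of_mem`).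
[cite: ChenTell2019, Def. 11 (p. 14)] -/
def CC0q (q : ℕ) : Set (Language Bool) :=
  {L | ∃ d k : ℕ, L ∈ CCdWIRESae q (d + 1) fun n => n ^ (k + 1)}

/-- **`CC⁰ = ∪_{q ≥ 2} CC⁰[q]`** (Definition 11). [cite: ChenTell2019, Def. 11 (p. 14)] -/
def CC0 : Set (Language Bool) := ⋃ q ≥ 2, CC0q q

/-- `ACdModWIRESae` is monotone in the wire bound (eventual domination suffices). [folklore] -/
theorem ACdModWIRESae_mono (q d : ℕ) {s s' : ℕ → ℕ} (h : ∃ n₁ : ℕ, ∀ n ≥ n₁, s n ≤ s' n) :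
    ACdModWIRESae q d s ⊆ ACdModWIRESae q d s' := by
  obtain ⟨n₁, hn₁⟩ := h
  exact FamilyAE_mono ⟨n₁, fun n hn C hC => ⟨hC.1, hC.2.1, hC.2.2.trans (hn₁ n hn)⟩⟩

/-- `ACdModWIRESae` is monotone in the depth. [folklore] -/
theorem ACdModWIRESae_mono_depth (q : ℕ) {d d' : ℕ} (h : d ≤ d') (s : ℕ → ℕ) :
    ACdModWIRESae q d s ⊆ ACdModWIRESae q d' s :=
  FamilyAE_mono ⟨0, fun _ _ _ hC => ⟨hC.1, hC.2.1.trans h, hC.2.2⟩⟩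

/-- `CCdWIRESae` is monotone in the wire bound (eventual domination suffices). [folklore] -/
theorem CCdWIRESae_mono (q d : ℕ) {s s' : ℕ → ℕ} (h : ∃ n₁ : ℕ, ∀ n ≥ n₁, s n ≤ s' n) :
    CCdWIRESae q d s ⊆ CCdWIRESae q d s' := by
  obtain ⟨n₁, hn₁⟩ := h
  exact FamilyAE_mono ⟨n₁, fun n hn C hC => ⟨hC.1, hC.2.1, hC.2.2.trans (hn₁ n hn)⟩⟩

/-- `CCdWIRESae` is monotone in the depth. [folklore] -/
theorem CCdWIRESae_mono_depth (q : ℕ) {d d' : ℕ} (h : d ≤ d') (s : ℕ → ℕ) :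
    CCdWIRESae q d s ⊆ CCdWIRESae q d' s :=
  FamilyAE_mono ⟨0, fun _ _ _ hC => ⟨hC.1, hC.2.1.trans h, hC.2.2⟩⟩

/-- `CC⁰_d[q]-WIRES[s] ⊆ AC⁰_d[q]-WIRES[s]` ("`CC⁰` is a subclass of `ACC⁰`", p. 8). [cite: ChenTell2019, §1.2.2 (p. 8)] -/
theorem CCdWIRESae_subset_ACdModWIRESae (q d : ℕ) (s : ℕ → ℕ) :
    CCdWIRESae q d s ⊆ ACdModWIRESae q d s :=
  FamilyAE_mono ⟨0, fun _ _ _ hC =>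
    ⟨fun g hg => ccBasis_subset_accBasis q (hC.1 g hg), hC.2.1, hC.2.2⟩⟩

/-- The shift in `CC0q` loses nothing: depth `d`, `n^k` wires ⟹ depth `d+1`, `n^(k+1)` wires
(for `n ≥ 1`). [folklore] -/
theorem mem_CC0q_of_mem {q d k : ℕ} {L : Language Bool} (h : L ∈ CCdWIRESae q d fun n => n ^ k) :
    L ∈ CC0q q := by
  refine ⟨d, k, CCdWIRESae_mono_depth q (Nat.le_succ d) _ (CCdWIRESae_mono q d ⟨1, ?_⟩ h)⟩
  intro n hn
  exact Nat.pow_le_pow_right hn (Nat.le_succ k)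

/-- `CC⁰[q] ⊆ CC⁰` for `q ≥ 2`. [cite: ChenTell2019, Def. 11 (p. 14)] -/
theorem CC0q_subset_CC0 {q : ℕ} (hq : 2 ≤ q) : CC0q q ⊆ CC0 := fun _ hL =>
  Set.mem_iUnion₂.2 ⟨q, hq, hL⟩

/-! ### Hardness hypotheses "just beyond" `n^{1+c^{−d}}` wires -/

/-- The hypothesis of Theorem 6 at base `c` (every modulus `q ≥ 2`): "there exist infinitely many
`d ∈ ℕ` such that MAJ cannot be computed by `ACC⁰` circuits of depth `d` with `n^{1+c^{−d}}` wires"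
(p. 8, L8–10). [cite: ChenTell2019, Thm. 6 (hypothesis, p. 8)] -/
def MajHardAtBase (c : ℝ) : Prop :=
  ∀ D : ℕ, ∃ d ≥ D, ∀ q : ℕ, 2 ≤ q → MAJ ∉ ACdModWIRESae q d (wireBound c d)

/-- The hypothesis of Theorem 7 at base `c` (every modulus `q ≥ 2`): "there exist infinitely many
`d ∈ ℕ` such that AND cannot be computed by `CC⁰` circuits of depth `d` with `n^{1+c^{−d}}` wires"
(p. 8, L39–42). [cite: ChenTell2019, Thm. 7 (hypothesis, p. 8)] -/
def AndHardAtBase (c : ℝ) : Prop :=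
  ∀ D : ℕ, ∃ d ≥ D, ∀ q : ℕ, 2 ≤ q → AND ∉ CCdWIRESae q d (wireBound c d)

/-- `wireBound` is antitone in the base (for lengths `n ≥ 1`). [folklore] -/
theorem wireBound_anti {c c' : ℝ} (hc : 1 ≤ c) (hcc' : c ≤ c') (d : ℕ) {n : ℕ} (hn : 1 ≤ n) :
    wireBound c' d n ≤ wireBound c d n := by
  have hn : (1 : ℝ) ≤ n := by exact_mod_cast hn
  have hc0 : 0 < c := by linarith
  refine Nat.floor_le_floor (Real.rpow_le_rpow_of_exponent_le hn ?_)
  have : c'⁻¹ ^ d ≤ c⁻¹ ^ d :=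
    pow_le_pow_left₀ (inv_nonneg.2 (by linarith)) (inv_anti₀ hc0 hcc') d
  linarith

/-- `MajHardAtBase` is monotone in the base: a larger base is a smaller wire budget. [folklore] -/
theorem MajHardAtBase.mono {c c' : ℝ} (hc : 1 ≤ c) (hcc' : c ≤ c') (h : MajHardAtBase c) :
    MajHardAtBase c' := by
  intro D
  obtain ⟨d, hd, hq⟩ := h D
  exact ⟨d, hd, fun q hq2 hmem => hq q hq2
    (ACdModWIRESae_mono q d ⟨1, fun n hn => wireBound_anti hc hcc' d hn⟩ hmem)⟩

/-- `AndHardAtBase` is monotone in the base. [folklore] -/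
theorem AndHardAtBase.mono {c c' : ℝ} (hc : 1 ≤ c) (hcc' : c ≤ c') (h : AndHardAtBase c) :
    AndHardAtBase c' := by
  intro D
  obtain ⟨d, hd, hq⟩ := h D
  exact ⟨d, hd, fun q hq2 hmem => hq q hq2
    (CCdWIRESae_mono q d ⟨1, fun n hn => wireBound_anti hc hcc' d hn⟩ hmem)⟩

/-! ### Row R45 — `MAJ` versus `ACC⁰` wires (Theorems 6 and 25) -/

/-- **[ChenTell2019, Theorem 25]** ("MAJ ∈ ACC⁰ iff MAJ is in extremely sparse ACC⁰"): "If
`MAJ ∈ ACC⁰`, then there exists a constant `c > 1` such that for every sufficiently large constant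
`d ∈ ℕ` it holds that MAJ can be solved by an `ACC⁰` circuit family with depth `d` and
`n^{1+c^{−d}}` wires."  Named fact (the modulus of the conclusion existential, decision 2).
[cite: ChenTell2019, Thm. 25 (p. 22)] -/
def thm25 : Prop :=
  MAJ ∈ ACC0 → ∃ c : ℝ, 1 < c ∧ ∃ D : ℕ, ∀ d ≥ D, ∃ q : ℕ, 2 ≤ q ∧
    MAJ ∈ ACdModWIRESae q d (wireBound c d)

/-- **[ChenTell2019, Theorem 6]** (hardness magnification for MAJ in `ACC⁰`): "Assume that for
every constant `c > 1` there exist infinitely many `d ∈ ℕ` such that MAJ cannot be computed by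
`ACC⁰` circuits of depth `d` with `n^{1+c^{−d}}` wires. Then, `MAJ ∉ ACC⁰`, and consequently
`ACC⁰ ≠ TC⁰`."  PROVED below from `thm25` (`thm6_of_thm25`). [cite: ChenTell2019, Thm. 6 (p. 8)] -/
def thm6 : Prop := (∀ c : ℝ, 1 < c → MajHardAtBase c) → MAJ ∉ ACC0 ∧ ACC0 ≠ TC0

/-- Theorem 6 is the contrapositive of Theorem 25 (p. 22: "whose contrapositive is Theorem 6"),
plus `MAJ ∈ TC⁰`. [cite: ChenTell2019, p. 22 (Thm. 6 from Thm. 25)] -/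
theorem thm6_of_thm25 (h : thm25) : thm6 := by
  intro hH
  have hnot : MAJ ∉ ACC0 := by
    intro hM
    obtain ⟨c, hc, D, hD⟩ := h hM
    obtain ⟨d, hd, hq⟩ := hH c hc D
    obtain ⟨q, hq2, hmem⟩ := hD d hd
    exact hq q hq2 hmem
  exact ⟨hnot, fun heq => hnot (heq ▸ MAJ_mem_TC0)⟩

/-- With the tree's PROVED inclusion `ACC0 ⊆ TC0` (`ACC0_subset_TC0_holds`, taken here by name to
keep the imports light) Theorem 6 gives a proper inclusion. [cite: ChenTell2019, Thm. 6 (p. 8)] -/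
theorem ACC0_ssubset_TC0_of_thm25 (h : thm25) (hsub : ACC0_subset_TC0)
    (hH : ∀ c : ℝ, 1 < c → MajHardAtBase c) : ACC0 ⊂ TC0 :=
  Set.ssubset_iff_subset_ne.2 ⟨hsub, (thm6_of_thm25 h hH).2⟩

/-- Monotonicity in the base: hardness at base `c` gives hardness at every base `c′ ≥ c`, so the
hypothesis of Theorem 6 is equivalent to hardness at bases arbitrarily close to `1`. [folklore] -/
theorem thm6_hypothesis_iff :
    (∀ c : ℝ, 1 < c → MajHardAtBase c) ↔ ∀ c : ℝ, 1 < c → ∃ c₀ : ℝ, 1 < c₀ ∧ c₀ ≤ c ∧ MajHardAtBase c₀ :=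
  ⟨fun h c hc => ⟨c, hc, le_rfl, h c hc⟩,
    fun h c hc => by obtain ⟨c₀, hc₀, hle, hH⟩ := h c hc; exact hH.mono hc₀.le hle⟩

/-! ### Row R46 — `AND` versus `CC⁰` wires (Theorem 7 and Corollary 23) -/

/-- **[ChenTell2019, Corollary 23 with the note after it]** (AND and `CC⁰`): if AND has `CC⁰[q]`
circuits of depth `d₀` and `n^k` wires (a.e.), then for every base `1 < c′ < e^{1/(k·d₀)}` and
every sufficiently large depth `d`, AND has `CC⁰` circuits of depth `d` and `⌊n^{1+(c′)^{−d}}⌋`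
wires (print: size `n^{1+2e³·c^{−d}}` with `c = e^{1/(k·d₀)}`, and "the conclusions … imply …
size `n^{1+(c′)^{−d}}`, where `c′ < e^{1/(k·d₀)}`").  For `k·d₀ = 0` the base interval is empty
(`1/0 = 0` in Lean) and the statement is vacuous, as is print's.  RENDERING OF THE HYPOTHESIS: the
almost-everywhere class `CCdWIRESae` makes the typed hypothesis WEAKER than print's every-length one,
hence the typed fact formally stronger than the displayed Corollary; this is implied by the printed
PROOF, not by the displayed statement — the recursion of Theorem 19 (pp. 18–19) invokes the
hypothesised circuits for AND only at input lengths tending to infinity and concludes "for every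
sufficiently large d" — the same mechanism as for `WordProblemWires.lean` (census referee findings
F23/F24).  Named fact. [cite: ChenTell2019, Cor. 23 (p. 21)] -/
def cor23 : Prop :=
  ∀ (q d₀ k : ℕ), 2 ≤ q → (AND ∈ CCdWIRESae q d₀ fun n => n ^ k) →
    ∀ c' : ℝ, 1 < c' → c' < Real.exp (1 / ((k : ℝ) * (d₀ : ℝ))) →
      ∃ D : ℕ, ∀ d ≥ D, ∃ q' : ℕ, 2 ≤ q' ∧ AND ∈ CCdWIRESae q' d (wireBound c' d)

/-- **[ChenTell2019, Theorem 7]** (hardness magnification for AND in `CC⁰`): "Assume that for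
every constant `c > 1` there exist infinitely many `d ∈ ℕ` such that AND cannot be computed by
`CC⁰` circuits of depth `d` with `n^{1+c^{−d}}` wires. Then, `CC⁰ ≠ ACC⁰`."  PROVED below from
`cor23` (`thm7_of_cor23`). [cite: ChenTell2019, Thm. 7 (p. 8)] -/
def thm7 : Prop := (∀ c : ℝ, 1 < c → AndHardAtBase c) → CC0 ≠ ACC0

/-- Theorem 7 from Corollary 23 (p. 8: "similarly to Theorem 2 … see Corollary 23"): if
`CC⁰ = ACC⁰` then `AND ∈ CC⁰[q]` with depth `d₀+1` and `n^{k+1}` wires for some `q ≥ 2`;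
Corollary 23 at a base `1 < c′ < e^{1/((k+1)(d₀+1))}` contradicts hardness at base `c′`.
[cite: ChenTell2019, p. 8 (Thm. 7 from Cor. 23)] -/
theorem thm7_of_cor23 (h : cor23) : thm7 := by
  intro hH heq
  have hA : AND ∈ CC0 := heq ▸ AND_mem_ACC0
  obtain ⟨q, hq⟩ := Set.mem_iUnion.1 hA
  obtain ⟨hq2, hAq⟩ := Set.mem_iUnion.1 hq
  obtain ⟨d₀, k, hmem⟩ := hAq
  set A : ℝ := 1 / ((((k + 1 : ℕ) : ℝ)) * (((d₀ + 1 : ℕ) : ℝ))) with hA_def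
  have hApos : 0 < A := by rw [hA_def]; positivity
  have hc1 : 1 < Real.exp (A / 2) := Real.one_lt_exp_iff.2 (by positivity)
  obtain ⟨D, hD⟩ := h q (d₀ + 1) (k + 1) hq2 hmem (Real.exp (A / 2)) hc1
    (Real.exp_lt_exp.2 (by linarith))
  obtain ⟨d, hd, hnone⟩ := hH _ hc1 D
  obtain ⟨q', hq', hmem'⟩ := hD d hd
  exact hnone q' hq' hmem'

/-! ### Non-vacuity of the new classes -/

/-- The `MOD_q` language: `x ∈ MODL q ↔ q ∤ #₁(x)`. [cite: ChenTell2019, Def. 11 (p. 14)] -/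
def MODL (q : ℕ) : Language Bool := {x | (GateFn.modGate q x.length).2 x.get = true}

/-- `MOD_q ∈ CC⁰_1[q]-WIRES[n]` (one gate): the classes `CCdWIRESae` are inhabited. [folklore] -/
theorem MODL_mem_CCdWIRESae (q : ℕ) : MODL q ∈ CCdWIRESae q 1 fun n => n := by
  refine ⟨fun n => Circuit.single (GateFn.modGate q n) (finCongr rfl), ⟨0, fun n _ => ⟨?_, ?_, ?_⟩⟩, ?_⟩
  · exact Circuit.single_isOver (modGate_mem_ccBasis q n) _
  · exact acDepth_single_le _ _
  · simp [GateFn.modGate]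
  · exact decides_single (GateFn.modGate q) (fun _ => rfl) (MODL q) fun x => Iff.rfl

/-- `MOD_q ∈ CC⁰[q]` and hence `CC⁰` is inhabited for `q ≥ 2`. [folklore] -/
theorem MODL_mem_CC0 {q : ℕ} (hq : 2 ≤ q) : MODL q ∈ CC0 :=
  CC0q_subset_CC0 hq (mem_CC0q_of_mem (k := 1) (by simpa using MODL_mem_CCdWIRESae q))

/-- `AND ∈ AC⁰_1[q]-WIRES[n]` (one gate): the classes `ACdModWIRESae` are inhabited. [folklore] -/
theorem AND_mem_ACdModWIRESae (q : ℕ) : AND ∈ ACdModWIRESae q 1 fun n => n := by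
  refine ⟨fun n => Circuit.single (GateFn.and n) (finCongr rfl), ⟨0, fun n _ => ⟨?_, ?_, ?_⟩⟩, ?_⟩
  · exact Circuit.single_isOver (and_mem_accBasis q n) _
  · exact acDepth_single_le _ _
  · simp [GateFn.and]
  · exact decides_single GateFn.and (fun _ => rfl) AND fun x => Iff.rfl

/-- The budget `⌊n^{1+c^{−d}}⌋` is at least `n`, so the one-gate witnesses live inside the classes
the hardness hypotheses speak about (`AND ∈ AC⁰_1[q]-WIRES[n^{1+c^{−d}}]`): the hypotheses of
Theorems 6/7 quantify over inhabited classes. [folklore] -/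
theorem le_wireBound {c : ℝ} (hc : 1 ≤ c) (d n : ℕ) : n ≤ wireBound c d n := by
  unfold wireBound
  refine Nat.le_floor ?_
  rcases Nat.eq_zero_or_pos n with hn | hn
  · subst hn; simpa using Real.rpow_nonneg le_rfl _
  · have hn1 : (1 : ℝ) ≤ n := by exact_mod_cast hn
    have h0 : (0 : ℝ) ≤ c⁻¹ ^ d := pow_nonneg (inv_nonneg.2 (by linarith)) d
    calc ((n : ℕ) : ℝ) = (n : ℝ) ^ (1 : ℝ) := (Real.rpow_one _).symm
      _ ≤ (n : ℝ) ^ (1 + c⁻¹ ^ d) := Real.rpow_le_rpow_of_exponent_le hn1 (by linarith)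

/-- `AND ∈ AC⁰_d[q]-WIRES[⌊n^{1+c^{−d}}⌋]` for every `q`, `c ≥ 1`, `d ≥ 1`: the classes in the
hypotheses of Theorems 6/7 are inhabited. [folklore] -/
theorem AND_mem_ACdModWIRESae_wireBound (q : ℕ) {c : ℝ} (hc : 1 ≤ c) (d : ℕ) (hd : 1 ≤ d) :
    AND ∈ ACdModWIRESae q d (wireBound c d) :=
  ACdModWIRESae_mono_depth q hd _
    (ACdModWIRESae_mono q 1 ⟨0, fun n _ => le_wireBound hc d n⟩ (AND_mem_ACdModWIRESae q))

example : thm25 → thm6 := thm6_of_thm25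
example : cor23 → thm7 := thm7_of_cor23

end Literature.Computability.MetaComplexity.ChenTell2019
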